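import Mathlib
import Summits.KontsevichZagierPeriods.Zeta5Search.DenomLaw.ConjugateRaiseLaw
import Summits.KontsevichZagierPeriods.Zeta5Search.LawA4Proof
import Summits.KontsevichZagierPeriods.Zeta5Search.DoubleDropBonusProof
import Summits.KontsevichZagierPeriods.Zeta5Search.LemmaDBonusTypes
import HarnessLib

/-!
# ζ(5) search — the CONJUGATE-RAISE LAW (`DenomLaw.ConjugateRaiseLaw`, casLB + 2) IS A THEOREM — DENOM-LAW prover-d1 gen 3

HONEST FRAMING: systematic search; no irrationality claim unless certified.  Cell `pub-zeta5`, track «DENOM-LAW», seat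
`denom-prover-d1` gen 3 (ATTEMPT-4).  `p`-adic valuation bounds for the explicit rational numbers
`Cas_j(b) = W(b+e_j)V(b) − W(b)V(b+e_j)`; nothing here is about ζ(5) and no model exponent moves.

Discharges BY NAME the candidate class law `DenomLaw.ConjugateRaiseLaw` (statement file `DenomLaw/ConjugateRaiseLaw.lean`,
denom-prover-d1 gen 2, pre-registered kit j186907: 21,174 hypothesis cells, 0 violations, 60 % tight): in the window
`5 ≤ p ≤ b₀ < p² − 2`, least multipole exponent `m` ODD, `m ≤ −7`, every class of exponent `m` centre-free of ONE exponent vector `T`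
up to reversal with `T` UNIT-MOVED (`T − reverse T = e_i − e_k`), every pole class of exponent `m + 1` a single raise of `T`/`reverse T`
or a tame single, singles `ν ≥ m + 1` ⟹ `v_p(Cas_j(b)) ≥ casLB + 2`.

THE PROOF IS A REDUCTION TO THEOREM A⁗ (`SecondOrder.LawA4`, PROVED in the tree: `lawA4_holds`, typer gen 12), one level up.
(§1) A unit-moved list is a NON-CENTRAL SINGLE RAISE OF A PALINDROME: `T − reverse T` is antisymmetric under reversal, so its
two non-zero entries sit at mirror positions `i`, `L − i` (`2i ≠ L`) with values `+1`, `−1`; hence `T = P + e_i`,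
`reverse T = P + e_{L−i}` with `P := T − e_i` a PALINDROME (`unitMoved_spec`).  (§2) Apply `LawA4` with the palindromic type `P`
and `M := 1 − m` (even, `≥ 8`): every multipole class has exponent `≥ m > −M`, so the deep level `−M` of A⁗ is EMPTY (its clause is
vacuous); the classes with `ν = −M + 1 = m` are exactly the CR-deep classes, whose type lists `T`, `reverse T` are single raises of
`P`; the classes with `ν = −M + 2 = m + 1` are the CR-sub-deep multipole classes, whose type lists — single raises of `T` or of
`reverse T` by (H2) — are admissible DOUBLE raises of `P` (`isRaise2`), while a single-pole class cannot have `ν = m + 1` under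
(H2)+(H0) (tame ⇒ `ν ≥ 0`; non-tame ⇒ `ν = E = m + 1` ⇒ tame by (H2)).  A⁗ gives `v_p(Cas_j) ≥ 7 − 2M = 2m + 5`, and
`casLB ≤ 3 + 2m` at a class of exponent `m` (`casLB_le_of_deep`).  In the language of ATTEMPT-3 §4: the "second-order
family-ratio law on the minimal conjugate pair" is A⁗'s raise-pair identity `(Ω,N)_x + (Ω,N)_x̄ ≡ a·τ(P) (mod p³)` read at the
pair `{P + e_i, P + e_{L−i}}`, and the sub-deep orbits are A⁗'s double-raise pairs `∥ τ(P)`; the hypothesis `p ≤ d(b)` of the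
statement is not needed.  Consequence (separate file): `RuleRAB.cell2_of_CR` / `ruleR2_strip_of_CR` become unconditional —
rule R2 on the census's A/B family (`t ≥ 8`, all `n`) is a tree theorem.
-/

open Finset

namespace Summit.KontsevichZagierPeriods.Zeta5Search.DenomLaw

open Summit.KontsevichZagierPeriods.Zeta5Search.CasoratianValuation (InPolytope shift casoratian)
open Summit.KontsevichZagierPeriods.Zeta5Search.WedgeDictionary (dOf)
open Summit.KontsevichZagierPeriods.Zeta5Search.ClusterValuation
open Summit.KontsevichZagierPeriods.Zeta5Search.SecondOrder (isRaise isRaise2 raiseAtList classTypeList topLevel LawA4 lawA4_holds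
  classTypeList_level level_bounds' le_b0_of_lt)

/-! ## §1 Lists: counting marked positions, and the shape of a unit-moved list -/

/-- Distinct positions of a list satisfying a Boolean test are counted by the filtered length. -/
theorem card_le_length_filter (q : ℤ → Bool) : ∀ (l : List ℤ) (S : Finset ℕ),
    (∀ k ∈ S, ∃ h : k < l.length, q (l[k]) = true) → S.card ≤ (l.filter q).length
  | [], S, hS => by
      have hS0 : S = ∅ := Finset.eq_empty_of_forall_notMem fun k hk => by
        obtain ⟨h, -⟩ := hS k hk
        simp at h
      simp [hS0]
  | x :: l, S, hS => by
      set S' : Finset ℕ := (S.erase 0).image (fun k => k - 1) with hS'def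
      have hS' : ∀ k ∈ S', ∃ h : k < l.length, q (l[k]) = true := by
        intro k hk
        obtain ⟨k₁, hk₁, rfl⟩ := Finset.mem_image.1 hk
        have hk₁0 : k₁ ≠ 0 := Finset.ne_of_mem_erase hk₁
        obtain ⟨h, hq⟩ := hS k₁ (Finset.mem_of_mem_erase hk₁)
        obtain ⟨k', rfl⟩ : ∃ k', k₁ = k' + 1 := ⟨k₁ - 1, by omega⟩
        have hlen : k' < l.length := by simpa using h
        refine ⟨by simpa using hlen, ?_⟩
        simpa using hq
      have ih := card_le_length_filter q l S' hS'
      have hinj : Set.InjOn (fun k : ℕ => k - 1) ↑(S.erase 0) := by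
        intro a ha c hc h
        have ha0 : a ≠ 0 := Finset.ne_of_mem_erase (Finset.mem_coe.1 ha)
        have hc0 : c ≠ 0 := Finset.ne_of_mem_erase (Finset.mem_coe.1 hc)
        simp only at h
        omega
      have hcard : S'.card = (S.erase 0).card := Finset.card_image_of_injOn hinj
      have hmono : (l.filter q).length ≤ ((x :: l).filter q).length := by
        rw [List.filter_cons]
        split_ifs <;> simp
      by_cases h0 : 0 ∈ S
      · obtain ⟨h00, hq0⟩ := hS 0 h0
        have hq0' : q x = true := by simpa using hq0
        have hlen : ((x :: l).filter q).length = (l.filter q).length + 1 := by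
          rw [List.filter_cons, if_pos hq0', List.length_cons]
        have hS1 : S.card = (S.erase 0).card + 1 := (Finset.card_erase_add_one h0).symm
        omega
      · have hS1 : S.erase 0 = S := Finset.erase_eq_of_notMem h0
        rw [hS1] at hcard
        omega

/-- Three distinct marked positions force a filtered length `≥ 3`. -/
theorem three_le_length_filter {q : ℤ → Bool} {l : List ℤ} {a c e : ℕ} (hac : a ≠ c) (hae : a ≠ e) (hce : c ≠ e)
    (ha : ∃ h : a < l.length, q (l[a]) = true) (hc : ∃ h : c < l.length, q (l[c]) = true)
    (he : ∃ h : e < l.length, q (l[e]) = true) : 3 ≤ (l.filter q).length := by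
  have h3 : ({a, c, e} : Finset ℕ).card = 3 := Finset.card_eq_three.2 ⟨a, c, e, hac, hae, hce, rfl⟩
  have := card_le_length_filter q l {a, c, e} (fun k hk => by
    simp only [Finset.mem_insert, Finset.mem_singleton] at hk
    rcases hk with rfl | rfl | rfl
    · exact ha
    · exact hc
    · exact he)
  omega

/-- **A unit-moved list is a non-central single raise of a palindrome.**  If `unitMoved T` holds then there are a PALINDROME `P`
(same length `L + 1`) and a position `i` with `2i ≠ L` such that `T = P + e_i` and `reverse T = P + e_{L−i}`
(`raiseAtList P i`, `raiseAtList P (L − i)`). -/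
theorem unitMoved_spec {T : List ℤ} (h : unitMoved T = true) :
    ∃ (P : List ℤ) (i : ℕ), P.length = T.length ∧ i < T.length ∧ T.length - 1 - i ≠ i ∧ P.reverse = P ∧
      T = raiseAtList P i ∧ T.reverse = raiseAtList P (T.length - 1 - i) := by
  simp only [unitMoved, Bool.and_eq_true, decide_eq_true_eq] at h
  obtain ⟨⟨h2, h1⟩, -⟩ := h
  set n := T.length with hn
  set d := List.zipWith (· - ·) T T.reverse with hd
  have hdl : d.length = n := by simp [hd, hn]
  have hdk : ∀ k (hk : k < n), d[k]'(by omega) = T[k]'hk - T[n - 1 - k]'(by omega) := by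
    intro k hk
    simp only [hd, List.getElem_zipWith, List.getElem_reverse, hn]
  -- the position carrying `+1`
  obtain ⟨i, hi, hdi⟩ : ∃ i, ∃ hi : i < n, d[i]'(by omega) = 1 := by
    have hpos : 0 < (d.filter (fun v => decide (v = 1))).length := by omega
    obtain ⟨a, ha⟩ := List.exists_mem_of_length_pos hpos
    rw [List.mem_filter] at ha
    obtain ⟨ha, ha1⟩ := ha
    obtain ⟨i, hi', rfl⟩ := List.mem_iff_getElem.1 ha
    exact ⟨i, by omega, by simpa using ha1⟩
  have hgetT : ∀ a c (ha : a < n) (hc : c < n), a = c → T[a]'ha = T[c]'hc := by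
    intro a c ha hc h; subst h; rfl
  have hTi : T[i]'hi = T[n - 1 - i]'(by omega) + 1 := by have := hdk i hi; rw [hdi] at this; linarith
  have hii : n - 1 - i ≠ i := by
    intro heq
    have := hdk i hi
    rw [hdi, hgetT (n - 1 - i) i (by omega) hi heq] at this
    linarith
  -- every other position is balanced
  have hzero : ∀ k (hk : k < n), k ≠ i → k ≠ n - 1 - i → T[k]'hk = T[n - 1 - k]'(by omega) := by
    intro k hk hki hkc
    by_contra hne
    have hq : ∀ j (hj : j < n), T[j]'hj ≠ T[n - 1 - j]'(by omega) →
        ∃ h : j < d.length, (fun v => decide (v ≠ 0)) (d[j]) = true := by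
      intro j hj hne'
      refine ⟨by omega, ?_⟩
      have := hdk j hj
      simp only [decide_eq_true_eq]
      rw [this]
      exact sub_ne_zero.2 hne'
    have h3 := three_le_length_filter (q := fun v => decide (v ≠ 0)) (l := d) hki hkc hii.symm
      (hq k hk hne) (hq i hi (by rw [hTi]; omega))
      (hq (n - 1 - i) (by omega) (by
        rw [hgetT (n - 1 - (n - 1 - i)) i (by omega) hi (by omega), hTi]; omega))
    omega
  -- the palindrome `P := T − e_i`
  set P : List ℤ := T.mapIdx (fun k e => if k = i then e - 1 else e) with hPdef
  have hPl : P.length = n := by simp [hPdef, hn]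
  have hPk : ∀ k (hk : k < n), P[k]'(by omega) = if k = i then T[k]'hk - 1 else T[k]'hk := by
    intro k hk
    simp only [hPdef, List.getElem_mapIdx]
  have hgetP : ∀ a c (ha : a < P.length) (hc : c < P.length), a = c → P[a]'ha = P[c]'hc := by
    intro a c ha hc h; subst h; rfl
  refine ⟨P, i, hPl, hi, hii, ?_, ?_, ?_⟩
  · -- `P` is a palindrome
    apply List.ext_getElem
    · simp
    · intro k hk1 hk2
      have hk : k < n := by omega
      rw [List.getElem_reverse, hgetP (P.length - 1 - k) (n - 1 - k) _ (by omega) (by omega),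
        hPk (n - 1 - k) (by omega), hPk k hk]
      by_cases hki : k = i
      · rw [if_neg (by omega), if_pos hki, hgetT (n - 1 - k) (n - 1 - i) _ (by omega) (by omega),
          hgetT k i hk hi hki, hTi]
        ring
      · rw [if_neg hki]
        by_cases hkc : k = n - 1 - i
        · rw [if_pos (by omega), hgetT (n - 1 - k) i _ hi (by omega), hTi, hgetT (n - 1 - i) k _ hk (by omega)]
          ring
        · rw [if_neg (by omega)]
          exact (hzero k hk hki hkc).symm
  · -- `T = P + e_i`
    apply List.ext_getElem
    · simp [raiseAtList, hPl, hn]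
    · intro k hk1 hk2
      have hk : k < n := by omega
      simp only [raiseAtList, List.getElem_mapIdx]
      rw [hPk k hk]
      split_ifs <;> ring
  · -- `reverse T = P + e_{L-i}`
    apply List.ext_getElem
    · simp [raiseAtList, hPl, hn]
    · intro k hk1 hk2
      have hk : k < n := by simp [raiseAtList, hPl] at hk2; exact hk2
      rw [List.getElem_reverse]
      simp only [raiseAtList, List.getElem_mapIdx]
      rw [hgetT (T.length - 1 - k) (n - 1 - k) _ (by omega) (by omega), hPk k hk]
      by_cases hkc : k = n - 1 - i
      · rw [if_pos hkc, if_neg (by omega), hgetT (n - 1 - k) i _ hi (by omega), hTi,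
          hgetT (n - 1 - i) k _ hk (by omega)]
      · rw [if_neg hkc]
        by_cases hki : k = i
        · rw [if_pos hki, hgetT (n - 1 - k) (n - 1 - i) _ (by omega) (by omega), hgetT k i hk hi hki, hTi]
          ring
        · rw [if_neg hki]
          exact (hzero k hk hki hkc).symm

/-- A raise at a position of `P` is a single raise of `P` (`isRaise`). -/
theorem isRaise_raiseAtList {P : List ℤ} {i : ℕ} (hi : i < P.length) : isRaise P (raiseAtList P i) = true := by
  unfold isRaise
  rw [Bool.or_eq_true, Bool.or_eq_true, List.any_eq_true]
  exact Or.inl (Or.inl ⟨i, List.mem_range.2 hi, by simp [raiseAtList]⟩)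

/-- A single raise of a raise of `P` is an admissible double raise of `P` (`isRaise2`). -/
theorem isRaise2_of_isRaise_raiseAtList {P S : List ℤ} {i : ℕ} (hi : i < P.length)
    (h : isRaise (raiseAtList P i) S = true) : isRaise2 P S = true := by
  unfold isRaise at h
  unfold isRaise2
  have hlen : (raiseAtList P i).length = P.length := by simp [raiseAtList]
  simp only [Bool.or_eq_true, List.any_eq_true, beq_iff_eq, List.mem_range] at h ⊢
  rcases h with (⟨k, hk, hS⟩ | hS) | hS
  · refine Or.inl (Or.inl (Or.inl (Or.inl ⟨i, hi, k, by omega, ?_⟩)))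
    rw [hS]
    rfl
  · exact Or.inl (Or.inl (Or.inl (Or.inr ⟨i, hi, Or.inl hS⟩)))
  · exact Or.inl (Or.inl (Or.inl (Or.inr ⟨i, hi, Or.inr hS⟩)))

/-! ## §2 Classes: the type list is the exponent vector -/

variable {p : ℕ} [hp : Fact p.Prime]

/-- For a residue `x < p ≤ b₀` the level type list `classTypeList` and the exponent vector `expVector` coincide. -/
theorem classTypeList_eq_expVector (b : ℕ → ℤ) {x : ℕ} (hpn : (p : ℤ) ≤ b 0) (hx : x < p) :
    classTypeList b p x = expVector b p x := by
  obtain ⟨hL, hL'⟩ := level_bounds' (p := p) b (le_b0_of_lt b hpn hx)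
  rw [classTypeList_level b hL hL', expVector_level b hx hL hL']

/-! ## §3 The law -/

omit hp in
/-- **THE CONJUGATE-RAISE LAW holds** (`DenomLaw.ConjugateRaiseLaw`, casLB + 2; by reduction to THEOREM A⁗ `SecondOrder.lawA4_holds`
with the palindrome `P` of `unitMoved_spec` and `M = 1 − m`). -/
theorem conjugateRaiseLaw_holds : ConjugateRaiseLaw := by
  intro b j p m T hb hj1 hj7 hb' hprime hp5 hpn _hpd hwin hodd hm7 hex hmin hunit H1 H2 H0 hcas
  haveI : Fact p.Prime := ⟨hprime⟩
  -- §1: `T = P + e_i`, `reverse T = P + e_{L-i}`, `P` a palindrome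
  obtain ⟨P, i, hPl, hi, hii, hPpal, hTP, hTrP⟩ := unitMoved_spec hunit
  have hiP : i < P.length := by omega
  have hiP' : T.length - 1 - i < P.length := by omega
  have hrT : isRaise P T = true := by rw [hTP]; exact isRaise_raiseAtList hiP
  have hrT' : isRaise P T.reverse = true := by rw [hTrP]; exact isRaise_raiseAtList hiP'
  -- the parameter `M = 1 − m` of THEOREM A⁗
  obtain ⟨M, hM⟩ : ∃ M : ℕ, (M : ℤ) = 1 - m := ⟨(1 - m).toNat, by omega⟩
  have hM6 : 6 ≤ M := by omega
  have hMe : Even M := by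
    obtain ⟨r, hr⟩ := hodd
    have : (M : ℤ) = 2 * (-r) := by omega
    exact (Int.even_coe_nat M).1 ⟨-r, by omega⟩
  -- `ν = E` off the tame singles
  have hnuE : ∀ y, 2 ≤ classPoleCount b p y → classNu b p y = classExp b p y := fun y h2 => by
    unfold classNu; rw [if_neg (by omega)]
  -- the hypotheses of A⁗
  have A1 : ∀ x ∈ multipoleClasses b p, -(M : ℤ) ≤ classExp b p x := fun x hx => by
    have := hmin x hx; omega
  have A2 : ∀ y, y < p → classPoleCount b p y = 1 → -(M : ℤ) + 1 ≤ classNu b p y := fun y hy h1 => by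
    have := H0 y hy h1; omega
  have A3 : ∀ x ∈ multipoleClasses b p, classExp b p x = -(M : ℤ) → ¬ CentreIn b p x ∧ classTypeList b p x = P := by
    intro x hx hE
    have := hmin x hx
    omega
  have A4 : ∀ y, y < p → 1 ≤ classPoleCount b p y → classNu b p y = -(M : ℤ) + 1 →
      isRaise P (classTypeList b p y) = true ∨ (¬ (2 : ℤ) ∣ b 0 ∧ CentreIn b p y ∧ classTypeList b p y = P) := by
    intro y hy h1 hnu
    by_cases h2 : 2 ≤ classPoleCount b p y
    · have hE : classExp b p y = m := by rw [← hnuE y h2]; omega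
      obtain ⟨-, hev⟩ := H1 y (mem_filter.2 ⟨mem_range.2 hy, h2⟩) hE
      left
      rw [classTypeList_eq_expVector b hpn hy]
      rcases hev with hev | hev
      · rw [hev]; exact hrT
      · rw [hev]; exact hrT'
    · have hone : classPoleCount b p y = 1 := by omega
      have := H0 y hy hone
      omega
  have A5 : ∀ z, z < p → 1 ≤ classPoleCount b p z → classNu b p z = -(M : ℤ) + 2 →
      isRaise2 P (classTypeList b p z) = true := by
    intro z hz h1 hnu
    by_cases h2 : 2 ≤ classPoleCount b p z
    · have hE : classExp b p z = m + 1 := by rw [← hnuE z h2]; omega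
      rcases H2 z hz h1 hE with ⟨-, hr⟩ | ⟨hone, -⟩
      · rw [classTypeList_eq_expVector b hpn hz]
        rcases hr with hr | hr
        · rw [hTP] at hr; exact isRaise2_of_isRaise_raiseAtList hiP hr
        · rw [hTrP] at hr; exact isRaise2_of_isRaise_raiseAtList hiP' hr
      · omega
    · have hone : classPoleCount b p z = 1 := by omega
      exfalso
      by_cases ht : tameSingle b p z = true
      · have : classNu b p z = max (classExp b p z) 0 := by
          unfold classNu; rw [if_pos ⟨hone, ht⟩]
        have h0 : (0 : ℤ) ≤ classNu b p z := by rw [this]; exact le_max_right _ _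
        omega
      · have hν : classNu b p z = classExp b p z := by
          unfold classNu; rw [if_neg (fun h => ht h.2)]
        have hE : classExp b p z = m + 1 := by rw [← hν]; omega
        rcases H2 z hz h1 hE with ⟨h2', -⟩ | ⟨-, ht'⟩
        · omega
        · exact ht ht'
  -- THEOREM A⁗ and the class bound at a deep class
  have hA4 := lawA4_holds b p j M P hb hb' hj1 hj7 hprime hp5 hpn hwin hM6 hMe hPpal A1 A2 A3 A4 A5 hcas
  obtain ⟨x, hx, hxE⟩ := hex
  obtain ⟨N, hN⟩ : ∃ N : ℕ, (N : ℤ) = -m := ⟨(-m).toNat, by omega⟩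
  have hLB := casLB_le_of_deep b hx (N := N) (by rw [hxE, hN]; ring)
  omega

end Summit.KontsevichZagierPeriods.Zeta5Search.DenomLaw
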